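import Mathlib.LinearAlgebra.Lagrange
import HarnessLib

/-!
# HANDOFF — the algebraic heart of the zero-dodger's EDGE IDENTITY: Lagrange interpolation at `0` (rh-explicit, track «HANDOFF», seat prove-2 gen7, ATTEMPT-15 §2.2)

HONEST FRAMING. Nothing here bears on the truth of RH; this is finite algebra over a field. In ATTEMPT-15 (HOME/handoff/prove-2/)
the zero-dodger `F₀` of prove-1's Theorem B — the window function on `[−b₁, b₁]` whose transform is
`E = S·L/Λ_K`, `S(ξ) = Π_{j≤K}(1 − ξ²/γ_j²)` (first `K` zeta zeros killed), `L(ξ) = sin(b₁ξ)/(b₁ξ)`, `Λ_K(ξ) = Π_{k≤K}(1 − ξ²/ℓ_k²)`,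
`ℓ_k = πk/b₁` — is the finite cosine series `F₀(x) = (1/2b₁)[1 + 2Σ_{k≤K}E(ℓ_k)cos(ℓ_k x)]` with
`E(ℓ_k) = S(ℓ_k)·(−1)^{k+1}/(2Π_{j≠k}(1 − ℓ_k²/ℓ_j²))`, so its EDGE VALUE is
`F₀(b₁⁻) = (1/2b₁)[1 − Σ_k S(ℓ_k)/Π_{j≠k}(1 − ℓ_k²/ℓ_j²)]`. The identity below (with `u_k = ℓ_k²`, `w_j = γ_j²`) evaluates that sum:

  **`Σ_k [Π_j(1 − u_k/w_j)]·Π_{j≠k} u_j/(u_j − u_k) = 1 − Π_k u_k/w_k`**,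

i.e. `F₀(b₁⁻) = c_∞/(2b₁)` with `c_∞ = Π_k ℓ_k²/γ_k²` EXACTLY — the dodger's edge value equals the constant governing its energy tail,
which is why `c_∞` cancels in the wall criterion (`HandoffDodgerCriterion`). PROOF: `P(u) := Π_j(1 − u/w_j)` and `c·Π_k(1 − u/u_k)`,
`c := Π u_k/w_k`, have the same degree `K` and leading coefficient, so their difference has degree `< K` and IS its Lagrange
interpolant at the `K` nodes `u_k`, where it takes the values `P(u_k)`; evaluate at `u = 0`. (Mathlib's `Lagrange.eq_interpolate`.)

References: classical (Lagrange interpolation); the use: this track, ATTEMPT-15 §2.2 (prove-2 gen7); the dodger: prove-1 ATTEMPT-6/7.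
-/

set_option linter.dupNamespace false

noncomputable section

open Polynomial Finset Lagrange

namespace Summit.RiemannHypothesis.RiemannHypothesis.Theorems.Handoff

variable {𝕜 : Type*} [Field 𝕜] {K : ℕ}

/-- `Π_j (C(−w_j⁻¹)·X + C 1)` evaluates to `Π_j(1 − x/w_j)`. [folklore] -/
theorem eval_oneSubDivProd (w : Fin K → 𝕜) (x : 𝕜) :
    (∏ j, (C (-(w j)⁻¹) * X + C (1 : 𝕜))).eval x = ∏ j, (1 - x / w j) := by
  simp only [eval_prod, eval_add, eval_mul, eval_C, eval_X]
  refine Finset.prod_congr rfl fun j _ ↦ ?_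
  rw [div_eq_mul_inv]; ring

/-- Its degree is `K` (all `w_j ≠ 0`). [folklore] -/
theorem degree_oneSubDivProd (w : Fin K → 𝕜) (hw : ∀ j, w j ≠ 0) :
    (∏ j, (C (-(w j)⁻¹) * X + C (1 : 𝕜))).degree = (K : WithBot ℕ) := by
  rw [degree_prod]
  have : ∀ j ∈ (univ : Finset (Fin K)), (C (-(w j)⁻¹) * X + C (1 : 𝕜)).degree = 1 := fun j _ ↦
    degree_linear (neg_ne_zero.2 (inv_ne_zero (hw j)))
  rw [Finset.sum_congr rfl this]
  simp

/-- Its leading coefficient is `Π_j(−w_j⁻¹)`. [folklore] -/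
theorem leadingCoeff_oneSubDivProd (w : Fin K → 𝕜) (hw : ∀ j, w j ≠ 0) :
    (∏ j, (C (-(w j)⁻¹) * X + C (1 : 𝕜))).leadingCoeff = ∏ j, (-(w j)⁻¹) := by
  rw [leadingCoeff_prod]
  exact Finset.prod_congr rfl fun j _ ↦ leadingCoeff_linear (neg_ne_zero.2 (inv_ne_zero (hw j)))

/-- It is a non-zero polynomial. [folklore] -/
theorem oneSubDivProd_ne_zero (w : Fin K → 𝕜) (hw : ∀ j, w j ≠ 0) :
    (∏ j, (C (-(w j)⁻¹) * X + C (1 : 𝕜))) ≠ 0 := by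
  intro h
  have := degree_oneSubDivProd w hw
  rw [h, degree_zero] at this
  exact WithBot.bot_ne_coe this

/-- The product vanishes at each of its nodes: `Π_j(1 − u_k/u_j) = 0`. [folklore] -/
theorem eval_oneSubDivProd_self (u : Fin K → 𝕜) (hu : ∀ j, u j ≠ 0) (k : Fin K) :
    (∏ j, (C (-(u j)⁻¹) * X + C (1 : 𝕜))).eval (u k) = 0 := by
  rw [eval_oneSubDivProd]
  exact Finset.prod_eq_zero (Finset.mem_univ k) (by rw [div_self (hu k), sub_self])

/-- Value of a Lagrange basis polynomial at `0`: `Π_{j≠k} u_j/(u_j − u_k)`. [folklore] -/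
theorem eval_zero_lagrange_basis (u : Fin K → 𝕜) (k : Fin K) :
    (Lagrange.basis univ u k).eval 0 = ∏ j ∈ univ.erase k, u j / (u j - u k) := by
  simp only [Lagrange.basis, eval_prod, basisDivisor, eval_mul, eval_C, eval_sub, eval_X, zero_sub]
  refine Finset.prod_congr rfl fun j _ ↦ ?_
  rw [div_eq_mul_inv, ← neg_sub (u j) (u k), inv_neg]
  ring

/-- **LAGRANGE AT ZERO (the edge identity's algebraic core).** For pairwise distinct non-zero nodes `u_k` and non-zero `w_k`
(`k < K`): `Σ_k [Π_j(1 − u_k/w_j)]·Π_{j≠k} u_j/(u_j − u_k) = 1 − Π_k u_k/w_k`. With `u_k = ℓ_k²` (lattice) and `w_k = γ_k²`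
(killed zeros) this is `2b₁·F₀(b₁⁻) = c_∞` for the zero-dodger (ATTEMPT-15 §2.2). [classical: Lagrange interpolation; this track, ATTEMPT-15 §2.2] -/
theorem sum_prod_oneSubDiv_mul_lagrange_zero (u w : Fin K → 𝕜) (hu : Function.Injective u)
    (hu0 : ∀ k, u k ≠ 0) (hw0 : ∀ k, w k ≠ 0) :
    ∑ k, (∏ j, (1 - u k / w j)) * ∏ j ∈ univ.erase k, u j / (u j - u k) = 1 - ∏ k, u k / w k := by
  classical
  set c : 𝕜 := ∏ k, u k / w k with hc
  set P : 𝕜[X] := ∏ j, (C (-(w j)⁻¹) * X + C (1 : 𝕜)) with hP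
  set Lp : 𝕜[X] := ∏ j, (C (-(u j)⁻¹) * X + C (1 : 𝕜)) with hLp
  set f : 𝕜[X] := P - C c * Lp with hf
  have hc0 : c ≠ 0 := Finset.prod_ne_zero_iff.2 fun k _ ↦ div_ne_zero (hu0 k) (hw0 k)
  -- degrees and leading coefficients agree
  have hdegP : P.degree = K := degree_oneSubDivProd w hw0
  have hdegL : (C c * Lp).degree = K := by
    rw [degree_C_mul hc0]; exact degree_oneSubDivProd u hu0
  have hlc : P.leadingCoeff = (C c * Lp).leadingCoeff := by
    rw [leadingCoeff_mul, leadingCoeff_C, leadingCoeff_oneSubDivProd w hw0, leadingCoeff_oneSubDivProd u hu0, hc,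
      ← Finset.prod_mul_distrib]
    refine Finset.prod_congr rfl fun k _ ↦ ?_
    field_simp [hu0 k, hw0 k]
  have hdegf : f.degree < (#(univ : Finset (Fin K)) : WithBot ℕ) := by
    rw [Finset.card_univ, Fintype.card_fin, ← hdegP]
    exact degree_sub_lt (hdegP.trans hdegL.symm) (oneSubDivProd_ne_zero w hw0) hlc
  -- f is its own interpolant at the nodes u
  have key := eq_interpolate (s := univ) (v := u) hu.injOn hdegf
  -- evaluate at 0
  have h0 : f.eval 0 = 1 - c := by
    simp only [hf, eval_sub, eval_mul, eval_C, hP, hLp, eval_oneSubDivProd, zero_div, sub_zero, Finset.prod_const_one,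
      mul_one]
  have hnode : ∀ k, f.eval (u k) = ∏ j, (1 - u k / w j) := fun k ↦ by
    simp only [hf, eval_sub, eval_mul, eval_C, hP, hLp, eval_oneSubDivProd_self u hu0 k, mul_zero, sub_zero,
      eval_oneSubDivProd]
  have h1 : (interpolate univ u fun i ↦ f.eval (u i)).eval 0 =
      ∑ k, (∏ j, (1 - u k / w j)) * ∏ j ∈ univ.erase k, u j / (u j - u k) := by
    rw [interpolate_apply, eval_finsetSum]
    refine Finset.sum_congr rfl fun k _ ↦ ?_
    rw [eval_mul, eval_C, hnode k, eval_zero_lagrange_basis]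
  rw [← h1, ← key, h0]

/-- The same with the reciprocal Lagrange weights written as `1/Π_{j≠k}(1 − u_k/u_j)` (the form in which the dodger's cosine
coefficients arrive): `Σ_k Π_j(1 − u_k/w_j) / Π_{j≠k}(1 − u_k/u_j) = 1 − Π_k u_k/w_k`. [classical; this track, ATTEMPT-15 §2.2] -/
theorem sum_prod_oneSubDiv_div_lagrange_zero (u w : Fin K → 𝕜) (hu : Function.Injective u)
    (hu0 : ∀ k, u k ≠ 0) (hw0 : ∀ k, w k ≠ 0) :
    ∑ k, (∏ j, (1 - u k / w j)) / ∏ j ∈ univ.erase k, (1 - u k / u j) = 1 - ∏ k, u k / w k := by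
  rw [← sum_prod_oneSubDiv_mul_lagrange_zero u w hu hu0 hw0]
  refine Finset.sum_congr rfl fun k _ ↦ ?_
  rw [div_eq_mul_inv, ← Finset.prod_inv_distrib]
  congr 1
  refine Finset.prod_congr rfl fun j _ ↦ ?_
  rw [one_sub_div (hu0 j), inv_div]

/-! ## The odd analogue (variant B of ATTEMPT-15: the odd dodger on the half-integer lattice)

For the ODD dodger `F = Σ_{k≤K+1} c_k sin(ℓ′_k x)` on `[−b₁, b₁]`, `ℓ′_k = (k − ½)π/b₁`, whose transform
`ξ·S(ξ)·cos(b₁ξ)/Π_{k≤K+1}(1 − ξ²/ℓ′_k²)` kills the same `K` zeros, the edge value is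
`F(b₁⁻) = ½·Σ_{m≤K+1} ℓ′_m² S(ℓ′_m)/Π_{k≠m}(1 − ℓ′_m²/ℓ′_k²)`; Lagrange interpolation of `u·P(u) + c·Π_m(1 − u/u_m)`,
`c = Π u_m/Π w_j` (degree `≤ K` after the leading terms cancel) at the `K + 1` nodes `u_m = ℓ′_m²` evaluates it: `F(b₁⁻) = ½·Πℓ′²/Πγ² =: J`. -/

/-- **LAGRANGE AT ZERO, odd form.** For `K + 1` pairwise distinct non-zero nodes `u_m` and `K` non-zero `w_j`:
`Σ_m u_m·[Π_j(1 − u_m/w_j)]·Π_{k≠m} u_k/(u_k − u_m) = Π_m u_m / Π_j w_j`. With `u_m = ℓ′_m²`, `w_j = γ_j²` this is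
`2·F(b₁⁻) = Πℓ′²/Πγ²` for the odd zero-dodger (ATTEMPT-15 §3, variant B). [classical: Lagrange interpolation; this track, ATTEMPT-15 §3] -/
theorem sum_mul_prod_oneSubDiv_mul_lagrange_zero_odd (u : Fin (K + 1) → 𝕜) (w : Fin K → 𝕜)
    (hu : Function.Injective u) (hu0 : ∀ k, u k ≠ 0) (hw0 : ∀ k, w k ≠ 0) :
    ∑ m, u m * (∏ j, (1 - u m / w j)) * ∏ k ∈ univ.erase m, u k / (u k - u m) =
      (∏ m, u m) / ∏ j, w j := by
  classical
  set c : 𝕜 := -((∏ m, u m) / ∏ j, w j) with hc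
  set P : 𝕜[X] := ∏ j, (C (-(w j)⁻¹) * X + C (1 : 𝕜)) with hP
  set Lp : 𝕜[X] := ∏ m, (C (-(u m)⁻¹) * X + C (1 : 𝕜)) with hLp
  set f : 𝕜[X] := X * P - C c * Lp with hf
  have hw : (∏ j, w j) ≠ 0 := Finset.prod_ne_zero_iff.2 fun j _ ↦ hw0 j
  have hup : (∏ m, u m) ≠ 0 := Finset.prod_ne_zero_iff.2 fun m _ ↦ hu0 m
  have hc0 : c ≠ 0 := neg_ne_zero.2 (div_ne_zero hup hw)
  have hdegP : P.degree = K := degree_oneSubDivProd w hw0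
  have hdegXP : (X * P).degree = ((K + 1 : ℕ) : WithBot ℕ) := by
    rw [degree_mul, degree_X, hdegP, Nat.cast_add, Nat.cast_one, add_comm]
  have hdegL : (C c * Lp).degree = ((K + 1 : ℕ) : WithBot ℕ) := by
    rw [degree_C_mul hc0]; exact degree_oneSubDivProd u hu0
  have h1 : (∏ j, (-(w j)⁻¹ : 𝕜)) = (-1) ^ K * (∏ j, w j)⁻¹ := by
    rw [Finset.prod_neg, Finset.prod_inv_distrib, Finset.card_univ, Fintype.card_fin]
  have h2 : (∏ m, (-(u m)⁻¹ : 𝕜)) = (-1) ^ (K + 1) * (∏ m, u m)⁻¹ := by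
    rw [Finset.prod_neg, Finset.prod_inv_distrib, Finset.card_univ, Fintype.card_fin]
  have hlc : (X * P).leadingCoeff = (C c * Lp).leadingCoeff := by
    rw [leadingCoeff_mul, leadingCoeff_X, one_mul, leadingCoeff_mul, leadingCoeff_C, leadingCoeff_oneSubDivProd w hw0,
      leadingCoeff_oneSubDivProd u hu0, h1, h2, hc]
    field_simp
    ring
  have hXP0 : X * P ≠ 0 := by
    intro h; rw [h, degree_zero] at hdegXP; exact WithBot.bot_ne_coe hdegXP
  have hdegf : f.degree < (#(univ : Finset (Fin (K + 1))) : WithBot ℕ) := by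
    rw [Finset.card_univ, Fintype.card_fin, ← hdegXP]
    exact degree_sub_lt (hdegXP.trans hdegL.symm) hXP0 hlc
  have key := eq_interpolate (s := univ) (v := u) hu.injOn hdegf
  have h0 : f.eval 0 = -c := by
    simp only [hf, eval_sub, eval_mul, eval_X, eval_C, hLp, eval_oneSubDivProd, zero_div, sub_zero, Finset.prod_const_one,
      mul_one, zero_mul, zero_sub]
  have hnode : ∀ m, f.eval (u m) = u m * ∏ j, (1 - u m / w j) := fun m ↦ by
    simp only [hf, eval_sub, eval_mul, eval_X, eval_C, hP, hLp, eval_oneSubDivProd_self u hu0 m, mul_zero, sub_zero,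
      eval_oneSubDivProd]
  have hev : (interpolate univ u fun i ↦ f.eval (u i)).eval 0 =
      ∑ m, u m * (∏ j, (1 - u m / w j)) * ∏ k ∈ univ.erase m, u k / (u k - u m) := by
    rw [interpolate_apply, eval_finsetSum]
    refine Finset.sum_congr rfl fun m _ ↦ ?_
    rw [eval_mul, eval_C, hnode m, eval_zero_lagrange_basis]
  rw [← hev, ← key, h0, hc, neg_neg]

end Summit.RiemannHypothesis.RiemannHypothesis.Theorems.Handoff
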